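import Literature.Computability.Cryptography.HallgrenClassGroupCipolla
import Literature.Computability.Complexity.FieldElementsFromCoins
import Literature.Computability.Complexity.CoinBlockRejectionSampling
import Literature.Computability.Complexity.CodeFPFinite
import Literature.Computability.Complexity.CodeFPListKit
import Literature.Computability.MetaComplexity.GapMINKTNWSampler
import HarnessLib

/-!
# Cipolla's square root on codes: one verified attempt, the search over coin blocks, and the
failure probability `(3/4)^m`

Machine layer over `HallgrenClassGroupCipolla.lean`. A randomised polynomial-time root finder reads
its trials `t` off COIN BLOCKS (`μ` bits each, value reduced modulo `p`, Arora–Barak §7.1/§A.2.2):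

* `Cipolla.omegaOf p n t = t² − n (mod p)` on naturals, `Cipolla.cand p n t` = the first coordinate of
  `(t + θ)^{(p+1)/2}` in `(ℤ/p)[θ]/(θ² − ω)` (the kernel `ArithFP.qpow`, modulus guarded by `gN`), and
  **`Cipolla.attempt p n t : Option ℕ`** = `some cand` iff the candidate VERIFIES (`cand² ≡ n`), so a
  returned root is always correct (`attempt_eq_some`); `attempt_ne_none` — when `ω` is a non-residue
  and `n` a residue the attempt succeeds (`sq_qpow_fst_eq`);
* **`Cipolla.rootSearch p n B`** = the first successful attempt over the blocks `B` (`List.findSome?`);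
  `rootSearch_eq_some`, `rootSearch_eq_none`;
* both on codes: `attemptC`, `rootSearchC` (typed `CodeFP` algebra: `qpowModC`, `findSomeFP`, `strVal`);
* the probability: **`uniformProb_attempt_none_le`** — over a uniform block of `μ ≥ log₂(8p)` bits a
  single attempt fails with probability `≤ 3/4` (at most `(p+1)/2` bad trials,
  `card_filter_isSquare_sq_sub_le`, pushed through the near-uniform reduction mod `p`,
  `CoinField.uniformProb_fieldTuple_le'`), and **`uniformProb_rootSearch_none_le`** — `m` attempts on
  `m` fresh blocks all fail with probability `≤ (3/4)^m` (`NWSamp.uniformProb_forall_blocks`).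

## References

* R. Crandall, C. Pomerance, *Prime Numbers: A Computational Perspective*, Springer, §2.3.2,
  Algorithm 2.3.8 [CrandallPomerance1999].
* S. Arora, B. Barak, *Computational Complexity: A Modern Approach*, CUP 2009, §7.1, §A.2.2
  [AroraBarak2009].
-/

namespace Literature.Computability.Cryptography.Hallgren2005

namespace Cipolla

open Polynomial ArithFP _root_.Computability Literature.Computability.Complexity
open Literature.Computability.Complexity.CodeFP HowellFP Finset

/-! ### One verified attempt and the search -/

/-- `ω = t² − n (mod p)` on naturals. [cite: CrandallPomerance1999, §2.3.2] -/
def omegaOf (p n t : ℕ) : ℕ := (t * t % p + (p - n % p)) % p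

/-- The candidate root: the first coordinate of `(t + θ)^{(p+1)/2}`, reduced. [cite: CrandallPomerance1999, §2.3.2 (Algorithm 2.3.8)] -/
def cand (p n t : ℕ) : ℕ := (qpow (omegaOf p n t) (gN p) (t, 1) ((p + 1) / 2)).1 % p

/-- **One attempt of Cipolla's algorithm with verification**: the candidate if it squares to `n`.
[cite: CrandallPomerance1999, §2.3.2 (Algorithm 2.3.8)] -/
def attempt (p n t : ℕ) : Option ℕ := if cand p n t * cand p n t % p = n % p then some (cand p n t) else none

/-- **The search**: the first successful attempt over the trial blocks (values of the coin blocks).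
[cite: AroraBarak2009, §7.1] -/
def rootSearch (p n : ℕ) (B : List (List Bool)) : Option ℕ := B.findSome? fun blk => attempt p n (bitsToNat blk)

/-- A returned root is a verified root `< p`. [folklore] -/
theorem attempt_eq_some {p n t u : ℕ} (hp : 0 < p) (h : attempt p n t = some u) : u < p ∧ u * u % p = n % p := by
  unfold attempt at h
  split_ifs at h with hc
  cases h
  exact ⟨Nat.mod_lt _ hp, hc⟩

/-- A returned root of the search is a verified root `< p`. [folklore] -/
theorem rootSearch_eq_some {p n u : ℕ} {B : List (List Bool)} (hp : 0 < p) (h : rootSearch p n B = some u) :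
    u < p ∧ u * u % p = n % p := by
  obtain ⟨blk, -, hb⟩ := List.exists_of_findSome?_eq_some h
  exact attempt_eq_some hp hb

/-- An unsuccessful search: every attempt failed. [folklore] -/
theorem rootSearch_eq_none {p n : ℕ} {B : List (List Bool)} (h : rootSearch p n B = none) :
    ∀ blk ∈ B, attempt p n (bitsToNat blk) = none := by
  rw [rootSearch, List.findSome?_eq_none_iff] at h
  exact h

/-- **Good trials succeed**: for an odd prime `p` and a residue `n`, if `t² − n` is a non-residue the
attempt returns a root. [cite: CrandallPomerance1999, §2.3.2 (Algorithm 2.3.8)] -/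
theorem attempt_ne_none {p : ℕ} [hp : Fact p.Prime] (hp2 : p ≠ 2) {n t : ℕ} (hn : IsSquare (n : ZMod p))
    (hω : ¬ IsSquare ((t : ZMod p) ^ 2 - n)) : attempt p n t ≠ none := by
  have hωeq : (omegaOf p n t : ZMod p) = (t : ZMod p) ^ 2 - n := natCast_omega n t
  have hωs : ¬ IsSquare (omegaOf p n t : ZMod p) := by rwa [hωeq]
  have hsq := sq_qpow_fst_eq hp2 hωeq hn hωs
  unfold attempt cand
  rw [gN_eq hp.out.ne_zero]
  have hc : ((qpow (omegaOf p n t) p (t, 1) ((p + 1) / 2)).1 % p * ((qpow (omegaOf p n t) p (t, 1) ((p + 1) / 2)).1 % p))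
      % p = n % p := by
    rw [← ZMod.natCast_eq_natCast_iff', Nat.cast_mul, ZMod.natCast_mod, ← sq, hsq]
  rw [if_pos hc]
  exact Option.some_ne_none _

/-! ### On codes -/

/-- `attempt` on codes, from `(p, n, t)`. [cite: AroraBarak2009, §1.3] -/
theorem attemptC : CodeFP (pairE natE (pairE natE natE)) (optE natE) (fun q => attempt q.1 q.2.1 q.2.2) := by
  have hp : CodeFP (pairE natE (pairE natE natE)) natE (fun q => q.1) := fst _ _
  have hn : CodeFP (pairE natE (pairE natE natE)) natE (fun q => q.2.1) := (snd _ _).fst'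
  have ht : CodeFP (pairE natE (pairE natE natE)) natE (fun q => q.2.2) := (snd _ _).snd'
  have hω : CodeFP (pairE natE (pairE natE natE)) natE (fun q => omegaOf q.1 q.2.1 q.2.2) :=
    (natMod.comp ((natAdd.comp ((natMod.comp ((natMul.comp (ht.pair ht)).pair hp)).pair
      (natSub.comp (hp.pair (natMod.comp (hn.pair hp)))))).pair hp)).congr fun _ => rfl
  have he : CodeFP (pairE natE (pairE natE natE)) natE (fun q => (q.1 + 1) / 2) :=
    natDiv.comp ((natAdd.comp (hp.pair (const _ (1 : ℕ)))).pair (const _ (2 : ℕ)))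
  have hx : CodeFP (pairE natE (pairE natE natE)) (pairE natE natE) (fun q => (q.2.2, (1 : ℕ))) := ht.pair (const _ (1 : ℕ))
  have hq := qpowModC.comp ((hω.pair hp).pair (hx.pair he))
  have hcand : CodeFP (pairE natE (pairE natE natE)) natE (fun q => cand q.1 q.2.1 q.2.2) :=
    (natMod.comp (hq.fst'.pair hp)).congr fun _ => rfl
  have hcond := natEq.comp ((natMod.comp ((natMul.comp (hcand.pair hcand)).pair hp)).pair (natMod.comp (hn.pair hp)))
  have h := ite hcond ((optSome natE).comp hcand) (const _ (none : Option ℕ))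
  exact h.congr fun q => by
    unfold attempt
    by_cases hc : cand q.1 q.2.1 q.2.2 * cand q.1 q.2.1 q.2.2 % q.1 = q.2.1 % q.1
    · rw [decide_eq_true hc, if_pos rfl, if_pos hc]
    · rw [decide_eq_false hc, if_neg Bool.false_ne_true, if_neg hc]

/-- `rootSearch` on codes, from `((p, n), B)`. [cite: AroraBarak2009, §1.3, §7.1] -/
theorem rootSearchC : CodeFP (pairE (pairE natE natE) (rawE strE)) (optE natE) (fun q => rootSearch q.1.1 q.1.2 q.2) := by
  have hin : CodeFP (pairE (pairE natE natE) strE) (pairE natE (pairE natE natE)) (fun q => (q.1.1, q.1.2, bitsToNat q.2)) :=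
    (fst _ _).fst'.pair ((fst _ _).snd'.pair (strVal.comp (snd _ _)))
  have hitem := attemptC.comp hin
  exact (findSomeFP hitem).congr fun q => rfl

/-! ### The failure probability -/

/-- **One attempt fails with probability `≤ 3/4`** over a uniform block of `μ` bits with `8p ≤ 2^μ`
(`p` an odd prime, `n` a non-zero residue): failure forces `t² − n` to be a square (`attempt_ne_none`),
at most `(p+1)/2` residues `t` do that, and the block value mod `p` is near-uniform. [cite: AroraBarak2009, §A.2.2] -/
theorem uniformProb_attempt_none_le {p : ℕ} [hp : Fact p.Prime] (hp2 : p ≠ 2) {n : ℕ} (hn : IsSquare (n : ZMod p))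
    (hn0 : (n : ZMod p) ≠ 0) {μ : ℕ} (hμ : 8 * p ≤ 2 ^ μ) :
    uniformProb μ {z | attempt p n (bitsToNat z) = none} ≤ 3 / 4 := by
  classical
  set Q : (Fin 1 → ZMod p) → Prop := fun τ => IsSquare (τ 0 ^ 2 - (n : ZMod p))
  set S : Set (List Bool) := {w | ∃ h : w.length = 1 * μ, Q (CoinField.fieldTuple p ⟨w, h⟩)}
  have key : uniformProb (1 * μ) S ≤ _ := CoinField.uniformProb_fieldTuple_le' p 1 μ Q
  have e : uniformProb (1 * μ) S = uniformProb μ S := by rw [one_mul]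
  rw [e] at key
  have hsub : uniformProb μ {z | attempt p n (bitsToNat z) = none} ≤ uniformProb μ S := by
    refine BlockRejection.uniformProb_mono_len fun w hw hz => ?_
    have hw' : w.length = 1 * μ := by rw [one_mul]; exact hw
    refine ⟨hw', ?_⟩
    have hval : CoinField.fieldTuple p ⟨w, hw'⟩ 0 = ((bitsToNat w : ℕ) : ZMod p) := by
      rw [CoinField.fieldTuple_apply]
      change (((bitsToNat ((w.drop ((0 : ℕ) * μ)).take μ)) : ℕ) : ZMod p) = _
      rw [zero_mul, List.drop_zero, List.take_of_length_le hw.le]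
    show IsSquare (CoinField.fieldTuple p ⟨w, hw'⟩ 0 ^ 2 - (n : ZMod p))
    rw [hval]
    by_contra hns
    exact attempt_ne_none hp2 hn hns hz
  refine hsub.trans (key.trans ?_)
  -- `#{Q} ≤ (p+1)/2`
  have hcardQ : (univ.filter Q).card = ((univ : Finset (ZMod p)).filter fun t => IsSquare (t ^ 2 - (n : ZMod p))).card := by
    refine card_nbij' (fun τ => τ 0) (fun t _ => t) (fun τ hτ => ?_) (fun t ht => ?_) (fun τ _ => ?_) (fun _ _ => rfl)
    · rw [mem_coe, mem_filter] at hτ ⊢; exact ⟨mem_univ _, hτ.2⟩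
    · rw [mem_coe, mem_filter] at ht ⊢; exact ⟨mem_univ _, ht.2⟩
    · funext i; simp only [Fin.eq_zero i]
  have hT := card_filter_isSquare_sq_sub_le hp2 hn0
  rw [← hcardQ] at hT
  have hQ : ((univ.filter Q).card : ℝ) ≤ ((p : ℝ) + 1) / 2 := by
    have : (2 * (univ.filter Q).card : ℝ) ≤ p + 1 := by exact_mod_cast hT
    linarith
  have hp3 : (3 : ℝ) ≤ p := by
    have := hp.out.two_le
    exact_mod_cast (show 3 ≤ p by omega)
  have hp0 : (0 : ℝ) < p := by linarith
  have h2μ : (p : ℝ) / 2 ^ μ ≤ 1 / 8 := by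
    have h8 : (8 * p : ℝ) ≤ 2 ^ μ := by exact_mod_cast hμ
    rw [div_le_div_iff₀ (by positivity) (by norm_num)]
    linarith
  calc ((univ.filter Q).card : ℝ) / (p : ℝ) ^ 1 * (1 + (p : ℝ) / 2 ^ μ) ^ 1
      = ((univ.filter Q).card : ℝ) / p * (1 + (p : ℝ) / 2 ^ μ) := by rw [pow_one, pow_one]
    _ ≤ ((p + 1) / 2 / p) * (1 + 1 / 8) :=
        mul_le_mul (div_le_div_of_nonneg_right hQ hp0.le) (by linarith) (by positivity) (by positivity)
    _ ≤ 3 / 4 := by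
        rw [div_div, ← sub_nonneg]
        have : (3 : ℝ) / 4 - (p + 1) / (2 * p) * (1 + 1 / 8) = (3 * p - 9) / (16 * p) := by
          field_simp; ring
        rw [this]
        exact div_nonneg (by linarith) (by positivity)

/-- **`m` attempts on `m` fresh blocks all fail with probability `≤ (3/4)^m`.** [cite: AroraBarak2009, §7.4.1, §A.2] -/
theorem uniformProb_rootSearch_none_le {p : ℕ} [hp : Fact p.Prime] (hp2 : p ≠ 2) {n : ℕ} (hn : IsSquare (n : ZMod p))
    (hn0 : (n : ZMod p) ≠ 0) {μ : ℕ} (hμ : 8 * p ≤ 2 ^ μ) (m : ℕ) :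
    uniformProb (m * μ) {c | rootSearch p n ((List.range m).map fun i => (c.drop (i * μ)).take μ) = none} ≤
      (3 / 4 : ℝ) ^ m := by
  have hsub : uniformProb (m * μ) {c | rootSearch p n ((List.range m).map fun i => (c.drop (i * μ)).take μ) = none} ≤
      uniformProb (m * μ) {c | ∀ i < m, (c.drop (i * μ)).take μ ∈ {z | attempt p n (bitsToNat z) = none}} := by
    refine BlockRejection.uniformProb_mono_len fun c _ hc => ?_
    intro i hi
    exact rootSearch_eq_none hc _ (List.mem_map.2 ⟨i, List.mem_range.2 hi, rfl⟩)
  refine hsub.trans ?_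
  rw [Literature.Computability.MetaComplexity.NWSamp.uniformProb_forall_blocks]
  exact pow_le_pow_left₀ (uniformProb_nonneg _ _) (uniformProb_attempt_none_le hp2 hn hn0 hμ) m

end Cipolla

end Literature.Computability.Cryptography.Hallgren2005
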